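import Mathlib
import Literature.NumberTheory.Transcendental.KZCalculusProofs
import Literature.NumberTheory.Transcendental.KZLogCalculusProofs
import Literature.NumberTheory.Transcendental.KZSemialgebraicComplex

/-!
# `OffTetraSectorKernel`, line `odd-hyperbolic-ladder`: rotations of the sphere in the
stereographic chart (`stub_sphereRotation`)

Stub `stub_sphereRotation` of the crux `OffTetraSectorKernel` (stmt-KontsevichZagierPeriods-10557,
route HyperbolicBloch), spherical rung 1. A rotation of `S²` acts on the stereographic chart
`w = p₀ + i p₁` by a unitary Möbius map `M(w) = (a w + b)/(−b̄ w + ā)`, `|a|² + |b|² = 1`, with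
`a, b` of real-algebraic real and imaginary parts. Such a map is an ISOMETRY of the spherical
metric `4 |dw|²/(1 + |w|²)²`:

* `|a w + b|² + |−b̄ w + ā|² = (|a|² + |b|²)(1 + |w|²) = 1 + |w|²` (`sphereRotation_normSq_add`);
* `M′(w) = (a ā + b b̄)/(−b̄ w + ā)² = 1/(−b̄ w + ā)²` (`sphereRotation_hasDerivAt_mobius`), so the
  real chart map `Φ p = (Re M w, Im M w)` has the conformal Fréchet derivative
  `(Re M′, −Im M′; Im M′, Re M′)` of determinant `|M′(w)|² = 1/|−b̄ w + ā|⁴`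
  (`sphereRotation_hasFDerivAt_det`);
* hence `4/(1 + |M w|²)² · |det Φ′| = 4/(1 + |w|²)²` (`sphereRotation_density`).

Moreover `M` is injective off its pole (cross-multiplication, `a ā + b b̄ = 1 ≠ 0`) and `Φ` is a
`ℚ`-semialgebraic map on any `ℚ`-semialgebraic set avoiding the pole (its coordinates are real
rational functions of `p₀, p₁` with real-algebraic coefficients: the complex-valued toolkit
`re_im_const/_add/_mul/_neg/_div` of `KZSemialgebraicComplex`). These are exactly the data of ONE
change-of-variables move (rule (2), `KZ.changeOfVariablesRel`) between two representations with
density `4/(1 + p₀² + p₁²)²` on `σ` and on `Φ(σ)`. No definitions are introduced; the pattern is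
that of the hyperbolic isometry moves (`HyperbolicBlochIsometryMoveInversion.lean`,
`HyperbolicBlochOffTetraSectorKernelStubMobiusCell.lean`).

References: M. Kontsevich, D. Zagier, *Periods* (2001), §1.2 rule (2); J. Bochnak, M. Coste,
M.-F. Roy, *Real Algebraic Geometry* (1998), §2.2.
-/

noncomputable section

open Set MeasureTheory
open Literature.NumberTheory.Transcendental Literature.ModelTheory.ExponentialFields
open scoped ComplexConjugate

namespace Summit.KontsevichZagierPeriods.HyperbolicBloch.OffTetraSectorKernel

/-! ### The unitary Möbius map `M(w) = (a w + b)/(−b̄ w + ā)` -/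

/-- The isometry identity `|a w + b|² + |−b̄ w + ā|² = (|a|² + |b|²)(1 + |w|²)`. [folklore] -/
theorem sphereRotation_normSq_add (a b w : ℂ) :
    Complex.normSq (a * w + b) + Complex.normSq (-(conj b) * w + conj a) =
      (Complex.normSq a + Complex.normSq b) * (1 + Complex.normSq w) := by
  simp only [Complex.normSq_apply, Complex.add_re, Complex.add_im, Complex.mul_re, Complex.mul_im,
    Complex.neg_re, Complex.neg_im, Complex.conj_re, Complex.conj_im]
  ring

/-- A unitary Möbius map (`a ā + b b̄ = 1`) is injective off its pole. [folklore] -/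
theorem sphereRotation_mobius_injective {a b w₁ w₂ : ℂ}
    (hab : Complex.normSq a + Complex.normSq b = 1)
    (h₁ : -(conj b) * w₁ + conj a ≠ 0) (h₂ : -(conj b) * w₂ + conj a ≠ 0)
    (h : (a * w₁ + b) / (-(conj b) * w₁ + conj a) = (a * w₂ + b) / (-(conj b) * w₂ + conj a)) :
    w₁ = w₂ := by
  rw [div_eq_div_iff h₁ h₂] at h
  have h1 : a * conj a + b * conj b = 1 := by
    rw [Complex.mul_conj, Complex.mul_conj]; exact_mod_cast hab
  linear_combination h - (w₁ - w₂) * h1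

/-- The complex derivative of a unitary Möbius map: `M′(w) = 1/(−b̄ w + ā)²`. [folklore] -/
theorem sphereRotation_hasDerivAt_mobius {a b w : ℂ} (hab : Complex.normSq a + Complex.normSq b = 1)
    (hD : -(conj b) * w + conj a ≠ 0) :
    HasDerivAt (fun z : ℂ => (a * z + b) / (-(conj b) * z + conj a))
      ((-(conj b) * w + conj a) ^ 2)⁻¹ w := by
  have h1 : a * conj a + b * conj b = 1 := by
    rw [Complex.mul_conj, Complex.mul_conj]; exact_mod_cast hab
  have hN : HasDerivAt (fun z : ℂ => a * z + b) a w := by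
    simpa only [id_eq, mul_one] using ((hasDerivAt_id w).const_mul a).add_const b
  have hD' : HasDerivAt (fun z : ℂ => -(conj b) * z + conj a) (-(conj b)) w := by
    simpa only [id_eq, mul_one] using ((hasDerivAt_id w).const_mul (-(conj b))).add_const (conj a)
  refine (hN.div hD' hD).congr_deriv ?_
  rw [show a * (-(conj b) * w + conj a) - (a * w + b) * -(conj b) = 1 from by linear_combination h1,
    inv_eq_one_div]

/-! ### The real chart map `Φ p = (Re M w, Im M w)`, `w = p₀ + i p₁` -/

/-- `Φ` is injective on any set avoiding the pole of `M`. [folklore] -/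
theorem sphereRotation_injOn {a b : ℂ} (hab : Complex.normSq a + Complex.normSq b = 1)
    (Φ : (Fin 2 → ℝ) → (Fin 2 → ℝ))
    (hΦ : ∀ p, Φ p = ![((a * ((p 0 : ℂ) + (p 1 : ℂ) * Complex.I) + b) /
        (-(conj b) * ((p 0 : ℂ) + (p 1 : ℂ) * Complex.I) + conj a)).re,
      ((a * ((p 0 : ℂ) + (p 1 : ℂ) * Complex.I) + b) /
        (-(conj b) * ((p 0 : ℂ) + (p 1 : ℂ) * Complex.I) + conj a)).im])
    {σ : Set (Fin 2 → ℝ)} (hD : ∀ p ∈ σ, -(conj b) * ((p 0 : ℂ) + (p 1 : ℂ) * Complex.I) + conj a ≠ 0) :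
    InjOn Φ σ := by
  intro p hp q hq hpq
  have hw : ((p 0 : ℂ) + (p 1 : ℂ) * Complex.I) = ((q 0 : ℂ) + (q 1 : ℂ) * Complex.I) := by
    apply sphereRotation_mobius_injective hab (hD p hp) (hD q hq)
    have h0 := congrFun hpq 0
    have h1 := congrFun hpq 1
    simp only [hΦ, Matrix.cons_val_zero, Matrix.cons_val_one, Matrix.cons_val_fin_one] at h0 h1
    exact Complex.ext h0 h1
  have h0 : p 0 = q 0 := by simpa using congrArg Complex.re hw
  have h1 : p 1 = q 1 := by simpa using congrArg Complex.im hw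
  funext i
  fin_cases i
  · exact h0
  · exact h1

/-- `Φ` is a `ℚ`-semialgebraic map on any `ℚ`-semialgebraic set avoiding the pole: its coordinates
are real rational functions of `p₀, p₁` with real-algebraic coefficients.
[cite: BochnakCosteRoy1998, §2.2] -/
theorem sphereRotation_isSemialgebraicMapOn {a b : ℂ} (hare : IsAlgebraic ℚ a.re)
    (haim : IsAlgebraic ℚ a.im) (hbre : IsAlgebraic ℚ b.re) (hbim : IsAlgebraic ℚ b.im)
    (Φ : (Fin 2 → ℝ) → (Fin 2 → ℝ))
    (hΦ : ∀ p, Φ p = ![((a * ((p 0 : ℂ) + (p 1 : ℂ) * Complex.I) + b) /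
        (-(conj b) * ((p 0 : ℂ) + (p 1 : ℂ) * Complex.I) + conj a)).re,
      ((a * ((p 0 : ℂ) + (p 1 : ℂ) * Complex.I) + b) /
        (-(conj b) * ((p 0 : ℂ) + (p 1 : ℂ) * Complex.I) + conj a)).im])
    {σ : Set (Fin 2 → ℝ)} (hσ : IsSemialgebraic ℚ σ)
    (hD : ∀ p ∈ σ, -(conj b) * ((p 0 : ℂ) + (p 1 : ℂ) * Complex.I) + conj a ≠ 0) :
    IsSemialgebraicMapOn ℚ σ Φ := by
  have hw : IsSemialgebraicFunOn ℚ σ (fun p : Fin 2 → ℝ => ((p 0 : ℂ) + (p 1 : ℂ) * Complex.I).re) ∧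
      IsSemialgebraicFunOn ℚ σ (fun p : Fin 2 → ℝ => ((p 0 : ℂ) + (p 1 : ℂ) * Complex.I).im) :=
    ⟨(isSemialgebraicFunOn_apply hσ 0).congr fun p _ => by simp,
      (isSemialgebraicFunOn_apply hσ 1).congr fun p _ => by simp⟩
  have ha := re_im_const hσ (c := a) hare haim
  have hb := re_im_const hσ (c := b) hbre hbim
  have hca := re_im_const hσ (c := conj a) (by simpa using hare) (by simpa using haim.neg)
  have hcb := re_im_neg (re_im_const hσ (c := conj b) (by simpa using hbre) (by simpa using hbim.neg))
  have hM := re_im_div (re_im_add (re_im_mul ha hw) hb) (re_im_add (re_im_mul hcb hw) hca) hD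
  refine IsSemialgebraicMapOn.of_forall hσ fun j => ?_
  fin_cases j
  · exact hM.1.congr fun p _ => by simp [hΦ]
  · exact hM.2.congr fun p _ => by simp [hΦ]

/-- **The derivative of `Φ` and its determinant.** Off the pole, `Φ` has the conformal Fréchet
derivative `(Re c, −Im c; Im c, Re c)`, `c = M′(w) = 1/(−b̄ w + ā)²`, of determinant
`|c|² = 1/|−b̄ w + ā|⁴`. [folklore] -/
theorem sphereRotation_hasFDerivAt_det {a b : ℂ} (hab : Complex.normSq a + Complex.normSq b = 1)
    (Φ : (Fin 2 → ℝ) → (Fin 2 → ℝ))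
    (hΦ : ∀ p, Φ p = ![((a * ((p 0 : ℂ) + (p 1 : ℂ) * Complex.I) + b) /
        (-(conj b) * ((p 0 : ℂ) + (p 1 : ℂ) * Complex.I) + conj a)).re,
      ((a * ((p 0 : ℂ) + (p 1 : ℂ) * Complex.I) + b) /
        (-(conj b) * ((p 0 : ℂ) + (p 1 : ℂ) * Complex.I) + conj a)).im])
    {p : Fin 2 → ℝ} (hD : -(conj b) * ((p 0 : ℂ) + (p 1 : ℂ) * Complex.I) + conj a ≠ 0) :
    ∃ L : (Fin 2 → ℝ) →L[ℝ] (Fin 2 → ℝ), HasFDerivAt Φ L p ∧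
      L.det = (Complex.normSq (-(conj b) * ((p 0 : ℂ) + (p 1 : ℂ) * Complex.I) + conj a) ^ 2)⁻¹ := by
  obtain ⟨c, hc⟩ : ∃ c : ℂ, c = ((-(conj b) * ((p 0 : ℂ) + (p 1 : ℂ) * Complex.I) + conj a) ^ 2)⁻¹ :=
    ⟨_, rfl⟩
  set Mx : Matrix (Fin 2) (Fin 2) ℝ := !![c.re, -c.im; c.im, c.re] with hMx
  set eL : (Fin 2 → ℝ) →L[ℝ] ℂ :=
    (ContinuousLinearMap.proj (R := ℝ) (φ := fun _ : Fin 2 => ℝ) 0).smulRight (1 : ℂ) +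
      (ContinuousLinearMap.proj (R := ℝ) (φ := fun _ : Fin 2 => ℝ) 1).smulRight Complex.I with hEL
  have heq : (fun q : Fin 2 → ℝ => (q 0 : ℂ) + (q 1 : ℂ) * Complex.I) = eL := by
    funext q
    simp [hEL, Complex.real_smul]
  have he : HasFDerivAt (fun q : Fin 2 → ℝ => (q 0 : ℂ) + (q 1 : ℂ) * Complex.I) eL p := by
    rw [heq]; exact eL.hasFDerivAt
  have hcomp := HasDerivAt.comp_hasFDerivAt
    (f := fun q : Fin 2 → ℝ => (q 0 : ℂ) + (q 1 : ℂ) * Complex.I) p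
    (hc ▸ sphereRotation_hasDerivAt_mobius hab hD) he
  refine ⟨LinearMap.toContinuousLinearMap (Matrix.toLin' Mx), ?_, ?_⟩
  · have h0 : HasFDerivAt (fun x => Φ x 0)
        ((ContinuousLinearMap.proj 0).comp (LinearMap.toContinuousLinearMap (Matrix.toLin' Mx))) p := by
      have hf : (fun x => Φ x 0) = fun x => (((fun z : ℂ => (a * z + b) / (-(conj b) * z + conj a)) ∘
          (fun q : Fin 2 → ℝ => (q 0 : ℂ) + (q 1 : ℂ) * Complex.I)) x).re := by
        funext x; rw [hΦ]; rfl
      rw [hf]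
      refine (Complex.reCLM.hasFDerivAt.comp p hcomp).congr_fderiv ?_
      refine ContinuousLinearMap.ext fun v => ?_
      simp [hMx, hEL, Matrix.toLin'_apply, dotProduct, Fin.sum_univ_two, Complex.real_smul]
    have h1 : HasFDerivAt (fun x => Φ x 1)
        ((ContinuousLinearMap.proj 1).comp (LinearMap.toContinuousLinearMap (Matrix.toLin' Mx))) p := by
      have hf : (fun x => Φ x 1) = fun x => (((fun z : ℂ => (a * z + b) / (-(conj b) * z + conj a)) ∘
          (fun q : Fin 2 → ℝ => (q 0 : ℂ) + (q 1 : ℂ) * Complex.I)) x).im := by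
        funext x; rw [hΦ]; rfl
      rw [hf]
      refine (Complex.imCLM.hasFDerivAt.comp p hcomp).congr_fderiv ?_
      refine ContinuousLinearMap.ext fun v => ?_
      simp [hMx, hEL, Matrix.toLin'_apply, dotProduct, Fin.sum_univ_two, Complex.real_smul]
    refine hasFDerivAt_pi'' fun i => ?_
    fin_cases i
    exacts [h0, h1]
  · rw [LinearMap.det_toContinuousLinearMap, LinearMap.det_toLin', Matrix.det_fin_two_of]
    have : c.re * c.re - -c.im * c.im = Complex.normSq c := by
      rw [Complex.normSq_apply]; ring
    rw [this, hc, map_inv₀, map_pow]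

/-- **The density is preserved**: `4/(1 + |w|²)² = 4/(1 + |M w|²)² · |M′(w)|²`. [folklore] -/
theorem sphereRotation_density {a b : ℂ} (hab : Complex.normSq a + Complex.normSq b = 1)
    (Φ : (Fin 2 → ℝ) → (Fin 2 → ℝ))
    (hΦ : ∀ p, Φ p = ![((a * ((p 0 : ℂ) + (p 1 : ℂ) * Complex.I) + b) /
        (-(conj b) * ((p 0 : ℂ) + (p 1 : ℂ) * Complex.I) + conj a)).re,
      ((a * ((p 0 : ℂ) + (p 1 : ℂ) * Complex.I) + b) /
        (-(conj b) * ((p 0 : ℂ) + (p 1 : ℂ) * Complex.I) + conj a)).im])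
    {x : Fin 2 → ℝ} (hD : -(conj b) * ((x 0 : ℂ) + (x 1 : ℂ) * Complex.I) + conj a ≠ 0) :
    4 / (1 + x 0 ^ 2 + x 1 ^ 2) ^ 2 = 4 / (1 + Φ x 0 ^ 2 + Φ x 1 ^ 2) ^ 2 *
      |(Complex.normSq (-(conj b) * ((x 0 : ℂ) + (x 1 : ℂ) * Complex.I) + conj a) ^ 2)⁻¹| := by
  have hnD : 0 < Complex.normSq (-(conj b) * ((x 0 : ℂ) + (x 1 : ℂ) * Complex.I) + conj a) :=
    Complex.normSq_pos.2 hD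
  have hsum : Complex.normSq (a * ((x 0 : ℂ) + (x 1 : ℂ) * Complex.I) + b) +
      Complex.normSq (-(conj b) * ((x 0 : ℂ) + (x 1 : ℂ) * Complex.I) + conj a) =
        1 + x 0 ^ 2 + x 1 ^ 2 := by
    rw [sphereRotation_normSq_add, hab, one_mul, Complex.normSq_add_mul_I, add_assoc]
  have hΦsq : Φ x 0 ^ 2 + Φ x 1 ^ 2 =
      Complex.normSq (a * ((x 0 : ℂ) + (x 1 : ℂ) * Complex.I) + b) /
        Complex.normSq (-(conj b) * ((x 0 : ℂ) + (x 1 : ℂ) * Complex.I) + conj a) := by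
    rw [← Complex.normSq_div, Complex.normSq_apply, hΦ]
    simp [sq]
  rw [abs_of_pos (inv_pos.2 (pow_pos hnD 2)), ← hsum, add_assoc, hΦsq]
  set u := Complex.normSq (a * ((x 0 : ℂ) + (x 1 : ℂ) * Complex.I) + b) with hu
  set v := Complex.normSq (-(conj b) * ((x 0 : ℂ) + (x 1 : ℂ) * Complex.I) + conj a) with hv
  clear_value u v
  have hnD' := hnD.ne'
  have h1 : 1 + u / v = (u + v) / v := by rw [add_div, div_self hnD', add_comm]
  rw [h1, div_pow, div_div_eq_mul_div, div_mul_eq_mul_div, mul_inv_cancel_right₀ (pow_ne_zero 2 hnD')]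

/-! ### The move -/

/-- **The sphere-rotation move, explicit form**: two density-`4/(1 + p₀² + p₁²)²` representations on
`σ` (avoiding the pole) and on `Φ(σ)` differ by ONE change-of-variables move.
[cite: KontsevichZagier2001, §1.2 rule (2)] -/
theorem sphereRotation_core {a b : ℂ} (hare : IsAlgebraic ℚ a.re) (haim : IsAlgebraic ℚ a.im)
    (hbre : IsAlgebraic ℚ b.re) (hbim : IsAlgebraic ℚ b.im)
    (hab : Complex.normSq a + Complex.normSq b = 1) (r r' : KZ.IntegralRep 2)
    (hD : ∀ p ∈ r.domain, -(conj b) * ((p 0 : ℂ) + (p 1 : ℂ) * Complex.I) + conj a ≠ 0)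
    (Φ : (Fin 2 → ℝ) → (Fin 2 → ℝ))
    (hΦ : ∀ p, Φ p = ![((a * ((p 0 : ℂ) + (p 1 : ℂ) * Complex.I) + b) /
        (-(conj b) * ((p 0 : ℂ) + (p 1 : ℂ) * Complex.I) + conj a)).re,
      ((a * ((p 0 : ℂ) + (p 1 : ℂ) * Complex.I) + b) /
        (-(conj b) * ((p 0 : ℂ) + (p 1 : ℂ) * Complex.I) + conj a)).im])
    (hdom : r'.domain = Φ '' r.domain)
    (hr : EqOn r.integrand (fun p => 4 / (1 + p 0 ^ 2 + p 1 ^ 2) ^ 2) r.domain)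
    (hr' : EqOn r'.integrand (fun p => 4 / (1 + p 0 ^ 2 + p 1 ^ 2) ^ 2) r'.domain) :
    KZ.of r - KZ.of r' ∈ KZ.relations := by
  -- a derivative at every point off the pole (chosen arbitrarily elsewhere)
  have hex : ∀ x : Fin 2 → ℝ, ∃ L : (Fin 2 → ℝ) →L[ℝ] (Fin 2 → ℝ),
      -(conj b) * ((x 0 : ℂ) + (x 1 : ℂ) * Complex.I) + conj a ≠ 0 →
        HasFDerivAt Φ L x ∧
          L.det = (Complex.normSq (-(conj b) * ((x 0 : ℂ) + (x 1 : ℂ) * Complex.I) + conj a) ^ 2)⁻¹ := by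
    intro x
    by_cases hx : -(conj b) * ((x 0 : ℂ) + (x 1 : ℂ) * Complex.I) + conj a = 0
    · exact ⟨0, fun h => (h hx).elim⟩
    · obtain ⟨L, hL, hdet⟩ := sphereRotation_hasFDerivAt_det hab Φ hΦ hx
      exact ⟨L, fun _ => ⟨hL, hdet⟩⟩
  choose Φ' hΦ' using hex
  refine KZ.changeOfVariablesRel_subset_relations ⟨2, r, r', Φ, Φ',
    sphereRotation_isSemialgebraicMapOn hare haim hbre hbim Φ hΦ r.isSemialgebraic_domain hD,
    fun x hx => ((hΦ' x (hD x hx)).1).hasFDerivWithinAt, sphereRotation_injOn hab Φ hΦ hD, hdom,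
    fun x hx => ?_, rfl⟩
  have hΦx : Φ x ∈ r'.domain := hdom ▸ mem_image_of_mem Φ hx
  rw [hr hx, hr' hΦx, (hΦ' x (hD x hx)).2]
  exact sphereRotation_density hab Φ hΦ (hD x hx)

/-- **STUB `stub_sphereRotation`** (rule (2), ONE move — rotations of the sphere are isometries of
the chart): for `a, b ∈ ℂ` with real-algebraic parts and `|a|² + |b|² = 1`, the Möbius map
`M(w) = (a w + b)/(−b̄ w + ā)` satisfies `(1 + |Mw|²)·|−b̄w + ā|² = 1 + |w|²` and
`|M′(w)| = 1/|−b̄w + ā|²`, so the density `4/(1 + |·|²)²` is preserved: any two density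
representations on `σ` (avoiding the pole) and on `M(σ)` are equivalent (`sphereRotation_core`).
[cite: KontsevichZagier2001, §1.2 rule (2)] -/
theorem stub_sphereRotation : ∀ (a b : ℂ), IsAlgebraic ℚ a.re → IsAlgebraic ℚ a.im → IsAlgebraic ℚ b.re → IsAlgebraic ℚ b.im → Complex.normSq a + Complex.normSq b = 1 → ∀ (r r' : KZ.IntegralRep 2), (∀ p ∈ r.domain, -(starRingEnd ℂ b) * ((p 0 : ℂ) + (p 1 : ℂ) * Complex.I) + starRingEnd ℂ a ≠ 0) → r'.domain = (fun p : Fin 2 → ℝ => ![((a * ((p 0 : ℂ) + (p 1 : ℂ) * Complex.I) + b) / (-(starRingEnd ℂ b) * ((p 0 : ℂ) + (p 1 : ℂ) * Complex.I) + starRingEnd ℂ a)).re, ((a * ((p 0 : ℂ) + (p 1 : ℂ) * Complex.I) + b) / (-(starRingEnd ℂ b) * ((p 0 : ℂ) + (p 1 : ℂ) * Complex.I) + starRingEnd ℂ a)).im]) '' r.domain → Set.EqOn r.integrand (fun p => 4 / (1 + p 0 ^ 2 + p 1 ^ 2) ^ 2) r.domain → Set.EqOn r'.integrand (fun p => 4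 / (1 + p 0 ^ 2 + p 1 ^ 2) ^ 2) r'.domain → KZ.of r - KZ.of r' ∈ KZ.relations := by
  intro a b hare haim hbre hbim hab r r' hD hdom hr hr'
  exact sphereRotation_core hare haim hbre hbim hab r r' hD _ (fun _ => rfl) hdom hr hr'

end Summit.KontsevichZagierPeriods.HyperbolicBloch.OffTetraSectorKernel

end
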